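import Mathlib
import HarnessLib
import Summits.Langlands.Statement
import Summits.Langlands.Langlands.Theses.MonodromyDichotomy
import Summits.Langlands.Langlands.Theses.SymmetricPowerAnchorSplit
import Summits.Langlands.Langlands.Theorems.MonodromyDichotomyLieIrreducibleAutomorphyOfResplit

/-!
# MonodromyDichotomySymmetricPowerAnchor — kernel support module for the child route `SymmetricPowerAnchorSplit`
(tree twin of the decomp-langlands lens-3 gen-14 node, rev 1; `--supports stmt-Langlands-31221`)

Node of record: HOME/nodes/lens-3-g14-SymmetricPowerAnchorSplit.lean (rev 1, sha256 707d859e13e9…, 502 lines, ns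
`…Theorems.SymmetricPowerAnchor`; NODE L993 / REV 1 L1027; crit-1 CLEARED rows 198 / 205; route-Langlands-SymmetricPowerAnchorSplit
rev 0 BORN L1001 @e5f851d33759, rev 1 EDIT L1031 @ccc8c78feed7, of-record rows 199 / 206).  Per the critic's advisory k3 (row 198)
this twin IMPORTS THE BORN ROUTE and states every kernel on the LEDGER declarations
`Summit.Langlands.Langlands.Theses.SymmetricPowerAnchorSplit.{AnchorlessSymTypeAutomorphy (RES, stmt-Langlands-28218),
CMSymmetricPowerAutomorphy (FC, 28219), LowSymmetricPowerAutomorphy (LS, 28220), HilbertSymmetricPowerAutomorphy (FT, 28221),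
SolvableAnchorTransport (T′, 28350), AvatarSymmetricPowerFrame (FRAME′, 28351), CliffordSolvableDescent (CSD, dedup
stmt-Langlands-31695), Assembly (28349)}` — the node's §1 local copies are therefore dropped (the route texts are byte-identical to
them, critic rows 205/206 EXACT ×7); §2 (vocabulary) and §3 (kernels) below are the node's, VERBATIM except that (i) the piece names
now resolve to the route declarations, (ii) the node's `closes` is not repeated (it IS the route file's deciding theorem
`Theses.SymmetricPowerAnchorSplit.closes`, glue 3d79949cdfc6 verbatim) and (iii) `assembly_iff_closes_shape` records that the
route's Assembly item is the curried deciding theorem.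

TARGET = SYM `Summit.Langlands.Langlands.Theses.MonodromyDichotomy.SymmetricPowerTransport` (stmt-Langlands-31221; layer-2 child of
G 25617 in route-Langlands-MonodromyDichotomy rev 3).  CUT (lens-3, ONE certified EQUIV with a split beneath it):
SYM ⟺ RES ∧ FC ∧ LS ∧ FT modulo the S-implied transport T′ fed with W⁺ (`MonodromyDichotomy.SatakeAvatarExistence`, the host
binder handed down by FRAME′) and CSD (`sym_iff_pieces`); restrictions `*_of_sym` (WEAKER ×4); `sym_of_pieces` (excluded middle on
«has a low anchor» for n ≤ 5 / «has a cohomological anchor» for n ≥ 6, unpack, apply the anchor-side piece over K₀, transport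
K₀ ⇝ M ⇝ K); FRAME′ certified from the host (`frame_of_host` = `MonodromyDichotomy.closes` ∘
`Theorems.LieIrreducibleAutomorphy_of_resplit_proof`); necessity `*_of_langlands` for all seven items + `pieces_of_langlands`;
orbit lemmas `lowAnchor_of_twist` / `cohomologicalAnchor_of_twist` (both dials saturated under character twists).  An ANCHOR of ρ
is (K₀, M, σ₀, ρ₀, χ): K₀ inside solvable Galois extensions of M ⊇ K, σ₀ : Γ_{K₀} → GL₂ irreducible geometric Lie-irreducible,
charpoly(ρ₀) = Sym^{n−1} charpoly(σ₀) (`IsSymShadow`), charpoly(ρ|_M) = χ-twist of charpoly(ρ₀|_M) (`TwistMatchOn`); COHOMOLOGICAL =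
K₀ TR/CM and σ₀ has a cuspidal partner with `InfinityType.IsLAlgebraic ∧ IsRegular` (census I-g14.3, v19 H80: for n = 2 this reads
the Harish-Chandra parameter only and forces weight ≥ 2 at every real place for cuspidal π₀).  Nothing here proves `Langlands`;
every theorem is a kernel identity, a restriction, a necessity certificate or an orbit lemma (rung 0).
-/

set_option linter.dupNamespace false
set_option maxHeartbeats 800000

namespace Summit.Langlands.Langlands.Theorems.MonodromyDichotomySymmetricPowerAnchor

open Summit.Langlands.Langlands.Theses.SymmetricPowerAnchorSplit (AnchorlessSymTypeAutomorphy CMSymmetricPowerAutomorphy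
  LowSymmetricPowerAutomorphy HilbertSymmetricPowerAutomorphy SolvableAnchorTransport AvatarSymmetricPowerFrame
  CliffordSolvableDescent Assembly)

/-! ## §1 Route items — by NAME (imported from `Summits.Langlands.Langlands.Theses.SymmetricPowerAnchorSplit`, rev 1) -/

/-- The route's Assembly item (stmt-Langlands-28349) is, by `Iff.rfl`, the curried shape of the deciding theorem
`Theses.SymmetricPowerAnchorSplit.closes` (binder order RES, FC, LS, FT, CSD, T′, FRAME′). -/
theorem assembly_iff_closes_shape :
    Assembly ↔ (AnchorlessSymTypeAutomorphy → CMSymmetricPowerAutomorphy → LowSymmetricPowerAutomorphy →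
      HilbertSymmetricPowerAutomorphy → CliffordSolvableDescent → SolvableAnchorTransport → AvatarSymmetricPowerFrame →
      _root_.Langlands) :=
  Iff.rfl

/-- FRAME′ (stmt-Langlands-28351) is, by `Iff.rfl`, the hand-down frame `(W⁺ → SYM) → Langlands` over the HOST's decls. -/
theorem frame_iff_host_shape :
    AvatarSymmetricPowerFrame ↔
      ((Summit.Langlands.Langlands.Theses.MonodromyDichotomy.SatakeAvatarExistence →
        Summit.Langlands.Langlands.Theses.MonodromyDichotomy.SymmetricPowerTransport) → _root_.Langlands) :=
  Iff.rfl

/-! ## §2 Node vocabulary (abbreviations; every bridge below is `Iff.rfl`) -/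

/-- pinned-geometric: a.e. unramified and de Rham at `v ∣ ℓ` for the PINNED Fontaine functor. -/
def IsPinnedGeometric (F : Type) [Field F] [NumberField F] (ℓ : ℕ) [Fact ℓ.Prime] {n : ℕ}
    (ρ : Literature.NumberTheory.GaloisRepresentations.FramedGaloisRep F (PadicAlgCl ℓ) n) : Prop :=
  ((∀ᶠ v : IsDedekindDomain.HeightOneSpectrum (NumberField.RingOfIntegers F) in Filter.cofinite, ρ.IsUnramifiedAt v) ∧ ∀ (v : IsDedekindDomain.HeightOneSpectrum (NumberField.RingOfIntegers F)) (hv : ((ℓ : ℕ) : NumberField.RingOfIntegers F) ∈ v.asIdeal), (Literature.NumberTheory.PAdicHodge.fontainePstAdicCompletion v ℓ hv).IsDeRhamFramed (ρ.toLocal v))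

/-- Lie-irreducible: irreducible on `Γ_L` for every number field `L ⊇ F`. -/
def IsLieIrreducible (F : Type) [Field F] [NumberField F] (ℓ : ℕ) [Fact ℓ.Prime] {n : ℕ}
    (ρ : Literature.NumberTheory.GaloisRepresentations.FramedGaloisRep F (PadicAlgCl ℓ) n) : Prop :=
  (∀ (L : Type) [Field L] [NumberField L] [Algebra F L], (ρ.restrictField L).toGaloisRep.IsIrreducible)

/-- weakly automorphic at level datum `hcpt`: an L-algebraic cuspidal `π` on `GL_n/F` with a.e. Satake–Frobenius compatibility. -/
def IsWeaklyAutomorphic (F : Type) [Field F] [NumberField F] (n : ℕ) (hcpt : Literature.NumberTheory.Automorphic.isCompact_glFiniteIntegralLevel n F) (ℓ : ℕ) [Fact ℓ.Prime]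
    (ι : PadicAlgCl ℓ ≃+* ℂ) (ρ : Literature.NumberTheory.GaloisRepresentations.FramedGaloisRep F (PadicAlgCl ℓ) n) : Prop :=
  ∃ π : Literature.NumberTheory.Automorphic.CuspidalAutomorphicRepData n F hcpt, π.1.IsLAlgebraic ∧ ∀ᶠ v : IsDedekindDomain.HeightOneSpectrum (NumberField.RingOfIntegers F) in Filter.cofinite, SatakeFrobCompatibleAt ι π.1 ρ v

/-- the rank induction hypothesis carried verbatim by SYM: weak automorphy of every irreducible pinned-geometric
Lie-irreducible `σ` of rank `m`, `2 ≤ m < n`, over every number field. -/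
def RankIH (n : ℕ) : Prop :=
  (∀ (m : ℕ), 2 ≤ m → m < n → ∀ (E : Type) [Field E] [NumberField E] (hE : Literature.NumberTheory.Automorphic.isCompact_glFiniteIntegralLevel m E) (ℓ' : ℕ) [Fact ℓ'.Prime] (ι' : PadicAlgCl ℓ' ≃+* ℂ) (σ : Literature.NumberTheory.GaloisRepresentations.FramedGaloisRep E (PadicAlgCl ℓ') m), σ.toGaloisRep.IsIrreducible → ((∀ᶠ v : IsDedekindDomain.HeightOneSpectrum (NumberField.RingOfIntegers E) in Filter.cofinite, σ.IsUnramifiedAt v) ∧ ∀ (v : IsDedekindDomain.HeightOneSpectrum (NumberField.RingOfIntegers E)) (hv : ((ℓ' : ℕ) : NumberField.RingOfIntegers E) ∈ v.asIdeal), (Literature.NumberTheory.PAdicHodge.fontainePstAdicCompletion v ℓ' hv).IsDeRhamFramed (σ.toLocal v)) → (∀ (L : Type) [Field L] [NumberField L] [Algebra E L], (σ.restrictField L).toGaloisRep.IsIrreducible) → ∃ π : Literature.NumberTheory.Automorphic.CuspidalAutomorphicRepData m E hE, π.1.IsLAlgebraic ∧ ∀ᶠ v : IsDedekindDomain.HeightOneSpectrum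 (NumberField.RingOfIntegers E) in Filter.cofinite, SatakeFrobCompatibleAt ι' π.1 σ v)

/-- progression spectra near `1` (the SYM box condition: eigenvalues `c, cr, …, cr^(n-1)` on a neighbourhood of `1`). -/
def HasProgressionSpectra (F : Type) [Field F] [NumberField F] (ℓ : ℕ) [Fact ℓ.Prime] (n : ℕ)
    (ρ : Literature.NumberTheory.GaloisRepresentations.FramedGaloisRep F (PadicAlgCl ℓ) n) : Prop :=
  (∃ U : Set (Field.absoluteGaloisGroup F), IsOpen U ∧ (1 : Field.absoluteGaloisGroup F) ∈ U ∧ ∀ g ∈ U, ∃ c r : PadicAlgCl ℓ, Literature.NumberTheory.GaloisRepresentations.FramedRep.charpoly ρ g = ∏ j ∈ Finset.range n, (Polynomial.X - Polynomial.C (c * r ^ j)))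

/-- `ρ₀` is the `Sym^(n-1)`-SHADOW of `σ₀`: simultaneously `charpoly σ₀(g) = (X-a)(X-ar)` and
`charpoly ρ₀(g) = ∏_j (X - a^(n-1) r^j)` for every `g ∈ Γ_F` (pointwise, no `Sym` functor needed). -/
def IsSymShadow (F : Type) [Field F] [NumberField F] (ℓ : ℕ) [Fact ℓ.Prime] (n : ℕ)
    (ρ₀ : Literature.NumberTheory.GaloisRepresentations.FramedGaloisRep F (PadicAlgCl ℓ) n) (σ₀ : Literature.NumberTheory.GaloisRepresentations.FramedGaloisRep F (PadicAlgCl ℓ) 2) : Prop :=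
  (∀ g : Field.absoluteGaloisGroup F, ∃ a r : PadicAlgCl ℓ, Literature.NumberTheory.GaloisRepresentations.FramedRep.charpoly σ₀ g = (Polynomial.X - Polynomial.C a) * (Polynomial.X - Polynomial.C (a * r)) ∧ Literature.NumberTheory.GaloisRepresentations.FramedRep.charpoly ρ₀ g = ∏ j ∈ Finset.range n, (Polynomial.X - Polynomial.C (a ^ (n - 1) * r ^ j)))

/-- twist-match on `Γ_M`: `ρ|Γ_M` and `ρ₀|Γ_M` have characteristic polynomials related by `scaleRoots (χ g)` for a
character `χ : Γ_M →* ℚ̄_ℓ` (Brauer–Nesbitt: `ρ|Γ_M ≃ ρ₀|Γ_M ⊗ χ` up to semisimplification). -/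
def TwistMatchOn (K K₀ M : Type) [Field K] [Field K₀] [Field M] [Algebra K M] [Algebra K₀ M] (ℓ : ℕ) [Fact ℓ.Prime]
    {n : ℕ} (ρ : Literature.NumberTheory.GaloisRepresentations.FramedGaloisRep K (PadicAlgCl ℓ) n) (ρ₀ : Literature.NumberTheory.GaloisRepresentations.FramedGaloisRep K₀ (PadicAlgCl ℓ) n) : Prop :=
  (∃ χ : Field.absoluteGaloisGroup M →* PadicAlgCl ℓ, ∀ g : Field.absoluteGaloisGroup M, Literature.NumberTheory.GaloisRepresentations.FramedRep.charpoly (ρ.restrictField M) g = (Literature.NumberTheory.GaloisRepresentations.FramedRep.charpoly (ρ₀.restrictField M) g).scaleRoots (χ g))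

/-- `M/F` has solvable Galois closure inside number fields. -/
def HasSolvableClosure (F M : Type) [Field F] [Field M] [Algebra F M] : Prop :=
  (∃ (N : Type) (_ : Field N) (_ : NumberField N) (_ : Algebra F N) (_ : Algebra M N) (_ : IsScalarTower F M N), IsGalois F N ∧ IsSolvable (N ≃ₐ[F] N))

/-- `σ₀` has a COHOMOLOGICAL automorphic partner: a cuspidal `π₀` on `GL₂/F` of REGULAR L-ALGEBRAIC infinity type,
a.e. Satake–Frobenius compatible with `σ₀` (regularity is read on `π₀`, not on Hodge–Tate weights). -/
def HasCohomologicalPartner (F : Type) [Field F] [NumberField F] (ℓ : ℕ) [Fact ℓ.Prime] (ι : PadicAlgCl ℓ ≃+* ℂ)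
    (σ₀ : Literature.NumberTheory.GaloisRepresentations.FramedGaloisRep F (PadicAlgCl ℓ) 2) : Prop :=
  (∃ (hcpt₂ : Literature.NumberTheory.Automorphic.isCompact_glFiniteIntegralLevel 2 F) (π₀ : Literature.NumberTheory.Automorphic.CuspidalAutomorphicRepData 2 F hcpt₂), (∃ T : Literature.NumberTheory.Automorphic.InfinityType F 2, π₀.1.HasInfinityType T ∧ T.IsLAlgebraic ∧ T.IsRegular) ∧ (∀ᶠ v : IsDedekindDomain.HeightOneSpectrum (NumberField.RingOfIntegers F) in Filter.cofinite, SatakeFrobCompatibleAt ι π₀.1 σ₀ v))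

/-- DIAL 1 (used for `n ≤ 5`): `ρ` has a Sym-ANCHOR — a number field `K₀`, a solvable sandwich `M ⊇ K, K₀`, an
irreducible pinned-geometric Lie-irreducible `σ₀ : Γ_{K₀} → GL₂` and its irreducible pinned-geometric Lie-irreducible
Sym-shadow `ρ₀` of rank `n` with `ρ|Γ_M` a twist of `ρ₀|Γ_M`. -/
def HasLowAnchor (K : Type) [Field K] [NumberField K] (ℓ : ℕ) [Fact ℓ.Prime] (n : ℕ)
    (ρ : Literature.NumberTheory.GaloisRepresentations.FramedGaloisRep K (PadicAlgCl ℓ) n) : Prop :=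
  (∃ (K₀ : Type) (_ : Field K₀) (_ : NumberField K₀) (M : Type) (_ : Field M) (_ : NumberField M) (_ : Algebra K M) (_ : Algebra K₀ M), (∃ (N : Type) (_ : Field N) (_ : NumberField N) (_ : Algebra K N) (_ : Algebra M N) (_ : IsScalarTower K M N), IsGalois K N ∧ IsSolvable (N ≃ₐ[K] N)) ∧ (∃ (N : Type) (_ : Field N) (_ : NumberField N) (_ : Algebra K₀ N) (_ : Algebra M N) (_ : IsScalarTower K₀ M N), IsGalois K₀ N ∧ IsSolvable (N ≃ₐ[K₀] N)) ∧ ∃ (σ₀ : Literature.NumberTheory.GaloisRepresentations.FramedGaloisRep K₀ (PadicAlgCl ℓ) 2) (ρ₀ : Literature.NumberTheory.GaloisRepresentations.FramedGaloisRep K₀ (PadicAlgCl ℓ) n), (ρ₀.toGaloisRep.IsIrreducible ∧ ((∀ᶠ v : IsDedekindDomain.HeightOneSpectrum (NumberField.RingOfIntegers K₀) in Filter.cofinite, ρ₀.IsUnramifiedAt v) ∧ ∀ (v : IsDedekindDomain.HeightOneSpectrum (NumberField.RingOfIntegers K₀)) (hv : ((ℓ : ℕ) : NumberField.RingOfIntegers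 K₀) ∈ v.asIdeal), (Literature.NumberTheory.PAdicHodge.fontainePstAdicCompletion v ℓ hv).IsDeRhamFramed (ρ₀.toLocal v)) ∧ (∀ (L : Type) [Field L] [NumberField L] [Algebra K₀ L], (ρ₀.restrictField L).toGaloisRep.IsIrreducible) ∧ (∀ g : Field.absoluteGaloisGroup K₀, ∃ a r : PadicAlgCl ℓ, Literature.NumberTheory.GaloisRepresentations.FramedRep.charpoly σ₀ g = (Polynomial.X - Polynomial.C a) * (Polynomial.X - Polynomial.C (a * r)) ∧ Literature.NumberTheory.GaloisRepresentations.FramedRep.charpoly ρ₀ g = ∏ j ∈ Finset.range n, (Polynomial.X - Polynomial.C (a ^ (n - 1) * r ^ j))) ∧ σ₀.toGaloisRep.IsIrreducible ∧ ((∀ᶠ v : IsDedekindDomain.HeightOneSpectrum (NumberField.RingOfIntegers K₀) in Filter.cofinite, σ₀.IsUnramifiedAt v) ∧ ∀ (v : IsDedekindDomain.HeightOneSpectrum (NumberField.RingOfIntegers K₀)) (hv : ((ℓ : ℕ) : NumberField.RingOfIntegers K₀) ∈ v.asIdeal), (Literature.NumberTheory.PAdicHodge.fontainePstAdicCompletion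 v ℓ hv).IsDeRhamFramed (σ₀.toLocal v)) ∧ (∀ (L : Type) [Field L] [NumberField L] [Algebra K₀ L], (σ₀.restrictField L).toGaloisRep.IsIrreducible)) ∧ (∃ χ : Field.absoluteGaloisGroup M →* PadicAlgCl ℓ, ∀ g : Field.absoluteGaloisGroup M, Literature.NumberTheory.GaloisRepresentations.FramedRep.charpoly (ρ.restrictField M) g = (Literature.NumberTheory.GaloisRepresentations.FramedRep.charpoly (ρ₀.restrictField M) g).scaleRoots (χ g)))

/-- DIAL 2 (used for `n ≥ 6`): `ρ` has a COHOMOLOGICAL TR/CM Sym-ANCHOR — as DIAL 1 with `K₀` totally real or CM and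
`σ₀` carrying a cohomological automorphic partner `π₀`. -/
def HasCohomologicalAnchor (K : Type) [Field K] [NumberField K] (ℓ : ℕ) [Fact ℓ.Prime] (ι : PadicAlgCl ℓ ≃+* ℂ) (n : ℕ)
    (ρ : Literature.NumberTheory.GaloisRepresentations.FramedGaloisRep K (PadicAlgCl ℓ) n) : Prop :=
  (∃ (K₀ : Type) (_ : Field K₀) (_ : NumberField K₀) (M : Type) (_ : Field M) (_ : NumberField M) (_ : Algebra K M) (_ : Algebra K₀ M), (NumberField.IsTotallyReal K₀ ∨ NumberField.IsCMField K₀) ∧ (∃ (N : Type) (_ : Field N) (_ : NumberField N) (_ : Algebra K N) (_ : Algebra M N) (_ : IsScalarTower K M N), IsGalois K N ∧ IsSolvable (N ≃ₐ[K] N)) ∧ (∃ (N : Type) (_ : Field N) (_ : NumberField N) (_ : Algebra K₀ N) (_ : Algebra M N) (_ : IsScalarTower K₀ M N), IsGalois K₀ N ∧ IsSolvable (N ≃ₐ[K₀] N)) ∧ ∃ (σ₀ : Literature.NumberTheory.GaloisRepresentations.FramedGaloisRep K₀ (PadicAlgCl ℓ) 2) (ρ₀ : Literature.NumberTheory.GaloisRepresentations.FramedGaloisRep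 K₀ (PadicAlgCl ℓ) n), (ρ₀.toGaloisRep.IsIrreducible ∧ ((∀ᶠ v : IsDedekindDomain.HeightOneSpectrum (NumberField.RingOfIntegers K₀) in Filter.cofinite, ρ₀.IsUnramifiedAt v) ∧ ∀ (v : IsDedekindDomain.HeightOneSpectrum (NumberField.RingOfIntegers K₀)) (hv : ((ℓ : ℕ) : NumberField.RingOfIntegers K₀) ∈ v.asIdeal), (Literature.NumberTheory.PAdicHodge.fontainePstAdicCompletion v ℓ hv).IsDeRhamFramed (ρ₀.toLocal v)) ∧ (∀ (L : Type) [Field L] [NumberField L] [Algebra K₀ L], (ρ₀.restrictField L).toGaloisRep.IsIrreducible) ∧ (∀ g : Field.absoluteGaloisGroup K₀, ∃ a r : PadicAlgCl ℓ, Literature.NumberTheory.GaloisRepresentations.FramedRep.charpoly σ₀ g = (Polynomial.X - Polynomial.C a) * (Polynomial.X - Polynomial.C (a * r)) ∧ Literature.NumberTheory.GaloisRepresentations.FramedRep.charpoly ρ₀ g = ∏ j ∈ Finset.range n, (Polynomial.X - Polynomial.C (a ^ (n - 1) * r ^ j))) ∧ σ₀.toGaloisRep.IsIrreducible ∧ ((∀ᶠ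 v : IsDedekindDomain.HeightOneSpectrum (NumberField.RingOfIntegers K₀) in Filter.cofinite, σ₀.IsUnramifiedAt v) ∧ ∀ (v : IsDedekindDomain.HeightOneSpectrum (NumberField.RingOfIntegers K₀)) (hv : ((ℓ : ℕ) : NumberField.RingOfIntegers K₀) ∈ v.asIdeal), (Literature.NumberTheory.PAdicHodge.fontainePstAdicCompletion v ℓ hv).IsDeRhamFramed (σ₀.toLocal v)) ∧ (∀ (L : Type) [Field L] [NumberField L] [Algebra K₀ L], (σ₀.restrictField L).toGaloisRep.IsIrreducible) ∧ (∃ (hcpt₂ : Literature.NumberTheory.Automorphic.isCompact_glFiniteIntegralLevel 2 K₀) (π₀ : Literature.NumberTheory.Automorphic.CuspidalAutomorphicRepData 2 K₀ hcpt₂), (∃ T : Literature.NumberTheory.Automorphic.InfinityType K₀ 2, π₀.1.HasInfinityType T ∧ T.IsLAlgebraic ∧ T.IsRegular) ∧ (∀ᶠ v : IsDedekindDomain.HeightOneSpectrum (NumberField.RingOfIntegers K₀) in Filter.cofinite, SatakeFrobCompatibleAt ι π₀.1 σ₀ v))) ∧ (∃ χ : Field.absoluteGaloisGroup M →* PadicAlgCl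 ℓ, ∀ g : Field.absoluteGaloisGroup M, Literature.NumberTheory.GaloisRepresentations.FramedRep.charpoly (ρ.restrictField M) g = (Literature.NumberTheory.GaloisRepresentations.FramedRep.charpoly (ρ₀.restrictField M) g).scaleRoots (χ g)))

/-! ## §3 Kernels — all sorry-free, axioms ⊆ {propext, Classical.choice, Quot.sound} -/

/-- vocabulary bridge: the K-side residual unfolds to the SYM box with the two negated dials. -/
theorem anchorless_iff :
    AnchorlessSymTypeAutomorphy ↔
      ∀ (K : Type) [Field K] [NumberField K] (n : ℕ) (hcpt : Literature.NumberTheory.Automorphic.isCompact_glFiniteIntegralLevel n K), 3 ≤ n → RankIH n →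
        ∀ (ℓ : ℕ) [Fact ℓ.Prime] (ι : PadicAlgCl ℓ ≃+* ℂ) (ρ : Literature.NumberTheory.GaloisRepresentations.FramedGaloisRep K (PadicAlgCl ℓ) n),
          ρ.toGaloisRep.IsIrreducible → IsPinnedGeometric K ℓ ρ → IsLieIrreducible K ℓ ρ → HasProgressionSpectra K ℓ n ρ →
          (n ≤ 5 → ¬ HasLowAnchor K ℓ n ρ) → (6 ≤ n → ¬ HasCohomologicalAnchor K ℓ ι n ρ) →
          IsWeaklyAutomorphic K n hcpt ℓ ι ρ :=
  Iff.rfl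

/-- vocabulary bridge for the host target SYM (stmt-Langlands-31221), read verbatim from the tree. -/
theorem sym_iff :
    Summit.Langlands.Langlands.Theses.MonodromyDichotomy.SymmetricPowerTransport ↔
      ∀ (K : Type) [Field K] [NumberField K] (n : ℕ) (hcpt : Literature.NumberTheory.Automorphic.isCompact_glFiniteIntegralLevel n K), 3 ≤ n → RankIH n →
        ∀ (ℓ : ℕ) [Fact ℓ.Prime] (ι : PadicAlgCl ℓ ≃+* ℂ) (ρ : Literature.NumberTheory.GaloisRepresentations.FramedGaloisRep K (PadicAlgCl ℓ) n),
          ρ.toGaloisRep.IsIrreducible → IsPinnedGeometric K ℓ ρ → IsLieIrreducible K ℓ ρ → HasProgressionSpectra K ℓ n ρ →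
          IsWeaklyAutomorphic K n hcpt ℓ ι ρ :=
  Iff.rfl

/-- vocabulary bridge: the low piece. -/
theorem low_iff :
    LowSymmetricPowerAutomorphy ↔
      ∀ (K₀ : Type) [Field K₀] [NumberField K₀] (n : ℕ) (hcpt : Literature.NumberTheory.Automorphic.isCompact_glFiniteIntegralLevel n K₀), 3 ≤ n → n ≤ 5 → RankIH n →
        ∀ (ℓ : ℕ) [Fact ℓ.Prime] (ι : PadicAlgCl ℓ ≃+* ℂ) (σ₀ : Literature.NumberTheory.GaloisRepresentations.FramedGaloisRep K₀ (PadicAlgCl ℓ) 2) (ρ₀ : Literature.NumberTheory.GaloisRepresentations.FramedGaloisRep K₀ (PadicAlgCl ℓ) n),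
          ρ₀.toGaloisRep.IsIrreducible → IsPinnedGeometric K₀ ℓ ρ₀ → IsLieIrreducible K₀ ℓ ρ₀ → IsSymShadow K₀ ℓ n ρ₀ σ₀ →
          σ₀.toGaloisRep.IsIrreducible → IsPinnedGeometric K₀ ℓ σ₀ → IsLieIrreducible K₀ ℓ σ₀ →
          IsWeaklyAutomorphic K₀ n hcpt ℓ ι ρ₀ :=
  Iff.rfl

/-- vocabulary bridge: the Hilbert (totally real anchor) piece. -/
theorem hilbert_iff :
    HilbertSymmetricPowerAutomorphy ↔
      ∀ (K₀ : Type) [Field K₀] [NumberField K₀] (n : ℕ) (hcpt : Literature.NumberTheory.Automorphic.isCompact_glFiniteIntegralLevel n K₀), 6 ≤ n → RankIH n → NumberField.IsTotallyReal K₀ →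
        ∀ (ℓ : ℕ) [Fact ℓ.Prime] (ι : PadicAlgCl ℓ ≃+* ℂ) (σ₀ : Literature.NumberTheory.GaloisRepresentations.FramedGaloisRep K₀ (PadicAlgCl ℓ) 2) (ρ₀ : Literature.NumberTheory.GaloisRepresentations.FramedGaloisRep K₀ (PadicAlgCl ℓ) n),
          ρ₀.toGaloisRep.IsIrreducible → IsPinnedGeometric K₀ ℓ ρ₀ → IsLieIrreducible K₀ ℓ ρ₀ → IsSymShadow K₀ ℓ n ρ₀ σ₀ →
          σ₀.toGaloisRep.IsIrreducible → IsPinnedGeometric K₀ ℓ σ₀ → IsLieIrreducible K₀ ℓ σ₀ → HasCohomologicalPartner K₀ ℓ ι σ₀ →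
          IsWeaklyAutomorphic K₀ n hcpt ℓ ι ρ₀ :=
  Iff.rfl

/-- vocabulary bridge: the CM-anchor piece. -/
theorem cm_iff :
    CMSymmetricPowerAutomorphy ↔
      ∀ (K₀ : Type) [Field K₀] [NumberField K₀] (n : ℕ) (hcpt : Literature.NumberTheory.Automorphic.isCompact_glFiniteIntegralLevel n K₀), 6 ≤ n → RankIH n → NumberField.IsCMField K₀ →
        ∀ (ℓ : ℕ) [Fact ℓ.Prime] (ι : PadicAlgCl ℓ ≃+* ℂ) (σ₀ : Literature.NumberTheory.GaloisRepresentations.FramedGaloisRep K₀ (PadicAlgCl ℓ) 2) (ρ₀ : Literature.NumberTheory.GaloisRepresentations.FramedGaloisRep K₀ (PadicAlgCl ℓ) n),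
          ρ₀.toGaloisRep.IsIrreducible → IsPinnedGeometric K₀ ℓ ρ₀ → IsLieIrreducible K₀ ℓ ρ₀ → IsSymShadow K₀ ℓ n ρ₀ σ₀ →
          σ₀.toGaloisRep.IsIrreducible → IsPinnedGeometric K₀ ℓ σ₀ → IsLieIrreducible K₀ ℓ σ₀ → HasCohomologicalPartner K₀ ℓ ι σ₀ →
          IsWeaklyAutomorphic K₀ n hcpt ℓ ι ρ₀ :=
  Iff.rfl

/-- vocabulary bridge: the transport support. -/
theorem transport_iff :
    SolvableAnchorTransport ↔
      Summit.Langlands.Langlands.Theses.MonodromyDichotomy.SatakeAvatarExistence → CliffordSolvableDescent →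
      ∀ (K : Type) [Field K] [NumberField K] (n : ℕ), 3 ≤ n → ∀ (ℓ : ℕ) [Fact ℓ.Prime] (ι : PadicAlgCl ℓ ≃+* ℂ)
        (ρ : Literature.NumberTheory.GaloisRepresentations.FramedGaloisRep K (PadicAlgCl ℓ) n), ρ.toGaloisRep.IsIrreducible → IsPinnedGeometric K ℓ ρ → IsLieIrreducible K ℓ ρ →
        HasProgressionSpectra K ℓ n ρ →
        ∀ (K₀ : Type) [Field K₀] [NumberField K₀] (M : Type) [Field M] [NumberField M] [Algebra K M] [Algebra K₀ M],
          HasSolvableClosure K M → HasSolvableClosure K₀ M → ∀ (ρ₀ : Literature.NumberTheory.GaloisRepresentations.FramedGaloisRep K₀ (PadicAlgCl ℓ) n),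
          ρ₀.toGaloisRep.IsIrreducible → IsPinnedGeometric K₀ ℓ ρ₀ → IsLieIrreducible K₀ ℓ ρ₀ → TwistMatchOn K K₀ M ℓ ρ ρ₀ →
          (∀ (hcpt₀ : Literature.NumberTheory.Automorphic.isCompact_glFiniteIntegralLevel n K₀), IsWeaklyAutomorphic K₀ n hcpt₀ ℓ ι ρ₀) →
          ∀ (hcpt : Literature.NumberTheory.Automorphic.isCompact_glFiniteIntegralLevel n K), IsWeaklyAutomorphic K n hcpt ℓ ι ρ :=
  Iff.rfl

/-- KERNEL 0 (dictionary lemma, syntactic): a Sym-shadow has progression spectra near `1`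
(`c := a^(n-1)`, `U := univ`) — so every anchor-side `ρ₀` lies in the SYM box. -/
theorem progression_of_symShadow {F : Type} [Field F] [NumberField F] {ℓ : ℕ} [Fact ℓ.Prime] {n : ℕ}
    {ρ₀ : Literature.NumberTheory.GaloisRepresentations.FramedGaloisRep F (PadicAlgCl ℓ) n} {σ₀ : Literature.NumberTheory.GaloisRepresentations.FramedGaloisRep F (PadicAlgCl ℓ) 2}
    (h : IsSymShadow F ℓ n ρ₀ σ₀) : HasProgressionSpectra F ℓ n ρ₀ := by
  refine ⟨Set.univ, isOpen_univ, Set.mem_univ _, fun g _ => ?_⟩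
  obtain ⟨a, r, -, h2⟩ := h g
  exact ⟨a ^ (n - 1), r, h2⟩

/-- KERNEL I (WEAKER, 1/4): the low piece is SYM restricted to the Sym-shadow sub-box with `n ≤ 5`. -/
theorem low_of_sym (hS : Summit.Langlands.Langlands.Theses.MonodromyDichotomy.SymmetricPowerTransport) : LowSymmetricPowerAutomorphy := by
  intro K₀ _ _ n hcpt h3 h5 hIH ℓ _ ι σ₀ ρ₀ hirr hPG hLI hSh _ _ _
  exact hS K₀ n hcpt h3 hIH ℓ ι ρ₀ hirr hPG hLI (progression_of_symShadow hSh)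

/-- KERNEL I (WEAKER, 2/4): the Hilbert piece is SYM restricted to the cohomologically anchored Sym-shadow sub-box over
totally real `K₀`, `n ≥ 6`. -/
theorem hilbert_of_sym (hS : Summit.Langlands.Langlands.Theses.MonodromyDichotomy.SymmetricPowerTransport) : HilbertSymmetricPowerAutomorphy := by
  intro K₀ _ _ n hcpt h6 hIH _ ℓ _ ι σ₀ ρ₀ hirr hPG hLI hSh _ _ _ _
  exact hS K₀ n hcpt (by omega) hIH ℓ ι ρ₀ hirr hPG hLI (progression_of_symShadow hSh)

/-- KERNEL I (WEAKER, 3/4): the CM piece is SYM restricted to the cohomologically anchored Sym-shadow sub-box over CM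
`K₀`, `n ≥ 6`. -/
theorem cm_of_sym (hS : Summit.Langlands.Langlands.Theses.MonodromyDichotomy.SymmetricPowerTransport) : CMSymmetricPowerAutomorphy := by
  intro K₀ _ _ n hcpt h6 hIH _ ℓ _ ι σ₀ ρ₀ hirr hPG hLI hSh _ _ _ _
  exact hS K₀ n hcpt (by omega) hIH ℓ ι ρ₀ hirr hPG hLI (progression_of_symShadow hSh)

/-- KERNEL I (WEAKER, 4/4): the residual is SYM restricted by the two negated dials. -/
theorem anchorless_of_sym (hS : Summit.Langlands.Langlands.Theses.MonodromyDichotomy.SymmetricPowerTransport) : AnchorlessSymTypeAutomorphy := by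
  intro K _ _ n hcpt h3 hIH ℓ _ ι ρ hirr hPG hLI hPS _ _
  exact hS K n hcpt h3 hIH ℓ ι ρ hirr hPG hLI hPS

/-- KERNEL II (the lens-3 TRANSLATION, closing direction): modulo the S-implied transport, the four pieces give SYM.
Pure logic: rank cut `n ≤ 5 ∣ n ≥ 6`, excluded middle on the dial, unpack the anchor, apply the anchor-side piece over
`K₀`, transport `K₀ ⇝ M ⇝ K`. -/
theorem sym_of_pieces (hW : Summit.Langlands.Langlands.Theses.MonodromyDichotomy.SatakeAvatarExistence) (hCSD : CliffordSolvableDescent)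
    (hLS : LowSymmetricPowerAutomorphy) (hFT : HilbertSymmetricPowerAutomorphy)
    (hFC : CMSymmetricPowerAutomorphy) (hRES : AnchorlessSymTypeAutomorphy) (hT : SolvableAnchorTransport) :
    Summit.Langlands.Langlands.Theses.MonodromyDichotomy.SymmetricPowerTransport := by
  intro K _ _ n hcpt h3 hIH ℓ _ ι ρ hirr hPG hLI hPS
  by_cases h5 : n ≤ 5
  · by_cases hR : HasLowAnchor K ℓ n ρ
    · obtain ⟨K₀, _, _, M, _, _, _, _, hKM, hK₀M, σ₀, ρ₀, ⟨h₁, h₂, h₃, h₄, h₅, h₆, h₇⟩, hTM⟩ := hR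
      exact hT hW hCSD K n h3 ℓ ι ρ hirr hPG hLI hPS K₀ M hKM hK₀M ρ₀ h₁ h₂ h₃ hTM
        (fun hcpt₀ => hLS K₀ n hcpt₀ h3 h5 hIH ℓ ι σ₀ ρ₀ h₁ h₂ h₃ h₄ h₅ h₆ h₇) hcpt
    · exact hRES K n hcpt h3 hIH ℓ ι ρ hirr hPG hLI hPS (fun _ => hR) (fun h6 => absurd h6 (by omega))
  · have h6 : 6 ≤ n := by omega
    by_cases hR : HasCohomologicalAnchor K ℓ ι n ρ
    · obtain ⟨K₀, _, _, M, _, _, _, _, hty, hKM, hK₀M, σ₀, ρ₀, ⟨h₁, h₂, h₃, h₄, h₅, h₆, h₇, h₈⟩, hTM⟩ := hR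
      rcases hty with hTR | hCM
      · exact hT hW hCSD K n h3 ℓ ι ρ hirr hPG hLI hPS K₀ M hKM hK₀M ρ₀ h₁ h₂ h₃ hTM
          (fun hcpt₀ => hFT K₀ n hcpt₀ h6 hIH hTR ℓ ι σ₀ ρ₀ h₁ h₂ h₃ h₄ h₅ h₆ h₇ h₈) hcpt
      · exact hT hW hCSD K n h3 ℓ ι ρ hirr hPG hLI hPS K₀ M hKM hK₀M ρ₀ h₁ h₂ h₃ hTM
          (fun hcpt₀ => hFC K₀ n hcpt₀ h6 hIH hCM ℓ ι σ₀ ρ₀ h₁ h₂ h₃ h₄ h₅ h₆ h₇ h₈) hcpt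
    · exact hRES K n hcpt h3 hIH ℓ ι ρ hirr hPG hLI hPS (fun h5' => absurd h5' h5) (fun _ => hR)

/-- KERNEL III (EXACTNESS — the ONE certified translation of lens-3): modulo the S-implied transport,
SYM ⟺ RES ∧ FC ∧ LS ∧ FT. (⟹) needs nothing; (⟸) is KERNEL II. -/
theorem sym_iff_pieces (hW : Summit.Langlands.Langlands.Theses.MonodromyDichotomy.SatakeAvatarExistence) (hCSD : CliffordSolvableDescent) (hT : SolvableAnchorTransport) :
    Summit.Langlands.Langlands.Theses.MonodromyDichotomy.SymmetricPowerTransport ↔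
      (AnchorlessSymTypeAutomorphy ∧ CMSymmetricPowerAutomorphy ∧ LowSymmetricPowerAutomorphy ∧ HilbertSymmetricPowerAutomorphy) :=
  ⟨fun hS => ⟨anchorless_of_sym hS, cm_of_sym hS, low_of_sym hS, hilbert_of_sym hS⟩,
   fun h => sym_of_pieces hW hCSD h.2.2.1 h.2.2.2 h.2.1 h.1 hT⟩

/-- KERNEL IV (FRAME from the host): the host's certified `MonodromyDichotomy.closes` composed with the landed resplit glue
`Theorems.LieIrreducibleAutomorphy_of_resplit_proof` (binder order SP, GEN, SYM, H) gives SYM → Langlands modulo the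
host's other binders — the frame is NOT a new claim. -/
theorem frame_of_host (h1 : Summit.Langlands.Langlands.Theses.MonodromyDichotomy.RankOneAutomorphy) (hSP : Summit.Langlands.Langlands.Theses.MonodromyDichotomy.SpecialCellAutomorphy) (hGE : Summit.Langlands.Langlands.Theses.MonodromyDichotomy.GenericModuliAutomorphy)
    (hH : Summit.Langlands.Langlands.Theses.MonodromyDichotomy.HigherLieRankAutomorphy) (hS : Summit.Langlands.Langlands.Theses.MonodromyDichotomy.ArtinTypeAutomorphy) (hT : Summit.Langlands.Langlands.Theses.MonodromyDichotomy.CliffordTateStructure)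
    (hX : Summit.Langlands.Langlands.Theses.MonodromyDichotomy.StructuredTransport) (hW : Summit.Langlands.Langlands.Theses.MonodromyDichotomy.SatakeAvatarExistence) (hP : Summit.Langlands.Langlands.Theses.MonodromyDichotomy.PadicMemberCompatibility)
    (hA : Summit.Langlands.Langlands.Theses.MonodromyDichotomy.CompatibilityAwayFromLR) (hR : Summit.Langlands.Langlands.Theses.MonodromyDichotomy.CanonicalReciprocityData) : AvatarSymmetricPowerFrame := fun hSYM =>
  Summit.Langlands.Langlands.Theses.MonodromyDichotomy.closes h1 (Summit.Langlands.Langlands.Theorems.LieIrreducibleAutomorphy_of_resplit_proof hSP hGE (hSYM hW) hH) hS hT hX hW hP hA hR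

/- ROOT CLOSURE: `closes (hRES hFC hLS hFT hCSD hT hF) : _root_.Langlands := hF (fun hW => sym_of_pieces hW hCSD hLS hFT hFC hRES hT)`
   is the route file's deciding theorem `Summit.Langlands.Langlands.Theses.SymmetricPowerAnchorSplit.closes` (not repeated here). -/


/-! ### Necessity certificates (Cert.*): every piece is implied by `_root_.Langlands` — no piece overshoots the summit. -/

/-- Cert: `Langlands ⇒ SYM` — clause (B) of the summit at `(K, n)` gives the weak automorphy conclusion outright. -/
theorem sym_of_langlands (hL : _root_.Langlands) : Summit.Langlands.Langlands.Theses.MonodromyDichotomy.SymmetricPowerTransport := by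
  intro K _ _ n hcpt h3 _ ℓ _ ι ρ hirr hPG _ _
  obtain ⟨⟨𝓡⟩, h⟩ := hL K
  obtain ⟨π, hLalg, hcorr⟩ := (h 𝓡 n (by omega) hcpt).2 ℓ ι ρ hirr hPG
  exact ⟨π, hLalg, hcorr.1⟩

/-- Cert: `Langlands ⇒ RES` (stmt-Langlands-28218), through SYM. -/
theorem anchorless_of_langlands (hL : _root_.Langlands) : AnchorlessSymTypeAutomorphy :=
  anchorless_of_sym (sym_of_langlands hL)

/-- Cert: `Langlands ⇒ LS` (stmt-Langlands-28220), through SYM. -/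
theorem low_of_langlands (hL : _root_.Langlands) : LowSymmetricPowerAutomorphy :=
  low_of_sym (sym_of_langlands hL)

/-- Cert: `Langlands ⇒ FT` (stmt-Langlands-28221), through SYM. -/
theorem hilbert_of_langlands (hL : _root_.Langlands) : HilbertSymmetricPowerAutomorphy :=
  hilbert_of_sym (sym_of_langlands hL)

/-- Cert: `Langlands ⇒ FC` (stmt-Langlands-28219), through SYM. -/
theorem cm_of_langlands (hL : _root_.Langlands) : CMSymmetricPowerAutomorphy :=
  cm_of_sym (sym_of_langlands hL)

/-- Cert: `Langlands ⇒ CSD` (dedup stmt-Langlands-31695): the conclusion alone is clause (B) over the base field. -/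
theorem csd_of_langlands (hL : _root_.Langlands) : CliffordSolvableDescent := by
  intro _ K _ _ n ℓ _ ι ρ hirr hPG hn
  intros
  rename_i hcpt
  obtain ⟨⟨𝓡⟩, h⟩ := hL K
  obtain ⟨π, hLalg, hcorr⟩ := (h 𝓡 n hn hcpt).2 ℓ ι ρ hirr hPG
  exact ⟨π, hLalg, hcorr.1⟩

/-- Cert: `Langlands ⇒ T′` (stmt-Langlands-28350): the conclusion alone is clause (B) at `(K, n)`. -/
theorem transport_of_langlands (hL : _root_.Langlands) : SolvableAnchorTransport := by
  intro _ _ K _ _ n h3 ℓ _ ι ρ hirr hPG _ _ K₀ _ _ M _ _ _ _ _ _ ρ₀ _ _ _ _ _ hcpt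
  obtain ⟨⟨𝓡⟩, h⟩ := hL K
  obtain ⟨π, hLalg, hcorr⟩ := (h 𝓡 n (by omega) hcpt).2 ℓ ι ρ hirr hPG
  exact ⟨π, hLalg, hcorr.1⟩

/-- Cert: `Langlands ⇒ FRAME′` (stmt-Langlands-28351), trivially. -/
theorem frame_of_langlands (hL : _root_.Langlands) : AvatarSymmetricPowerFrame := fun _ => hL

/-- Cert: all seven ledger items are `Langlands`-implied — no piece overshoots the summit. -/
theorem pieces_of_langlands (hL : _root_.Langlands) :
    AnchorlessSymTypeAutomorphy ∧ CMSymmetricPowerAutomorphy ∧ LowSymmetricPowerAutomorphy ∧ HilbertSymmetricPowerAutomorphy ∧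
      CliffordSolvableDescent ∧ SolvableAnchorTransport ∧ AvatarSymmetricPowerFrame :=
  ⟨anchorless_of_langlands hL, cm_of_langlands hL, low_of_langlands hL, hilbert_of_langlands hL, csd_of_langlands hL,
   transport_of_langlands hL, frame_of_langlands hL⟩

/-! ### Orbit lemmas (PROVED): both dials are saturated under the twist move of the transfer groupoid on the K-side. -/

/-- KERNEL V: a character twist of `ρ` (pointwise `scaleRoots`) inherits any low anchor of `ρ` (same `K₀, M, σ₀, ρ₀`;
the new twist character is `χ · (χ₁ ∘ res)`). -/
theorem lowAnchor_of_twist {K : Type} [Field K] [NumberField K] {ℓ : ℕ} [Fact ℓ.Prime] {n : ℕ}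
    {ρ ρ' : Literature.NumberTheory.GaloisRepresentations.FramedGaloisRep K (PadicAlgCl ℓ) n}
    (hχ : ∃ χ₁ : Field.absoluteGaloisGroup K →* PadicAlgCl ℓ, ∀ g : Field.absoluteGaloisGroup K,
      Literature.NumberTheory.GaloisRepresentations.FramedRep.charpoly ρ' g = (Literature.NumberTheory.GaloisRepresentations.FramedRep.charpoly ρ g).scaleRoots (χ₁ g))
    (h : HasLowAnchor K ℓ n ρ) : HasLowAnchor K ℓ n ρ' := by
  obtain ⟨χ₁, hχ₁⟩ := hχ
  obtain ⟨K₀, iF, iN, M, iFM, iNM, iA, iA₀, hKM, hK₀M, σ₀, ρ₀, hA, χ, hχ⟩ := h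
  refine ⟨K₀, iF, iN, M, iFM, iNM, iA, iA₀, hKM, hK₀M, σ₀, ρ₀, hA,
    χ * χ₁.comp (Literature.NumberTheory.GaloisRepresentations.absGaloisRestrict K M).toMonoidHom, fun g => ?_⟩
  have e1 : Literature.NumberTheory.GaloisRepresentations.FramedRep.charpoly (ρ'.restrictField M) g =
      Literature.NumberTheory.GaloisRepresentations.FramedRep.charpoly ρ' (Literature.NumberTheory.GaloisRepresentations.absGaloisRestrict K M g) := rfl
  have e2 : Literature.NumberTheory.GaloisRepresentations.FramedRep.charpoly (ρ.restrictField M) g =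
      Literature.NumberTheory.GaloisRepresentations.FramedRep.charpoly ρ (Literature.NumberTheory.GaloisRepresentations.absGaloisRestrict K M g) := rfl
  rw [e1, hχ₁, ← e2, hχ g, ← Polynomial.scaleRoots_mul]
  rfl

/-- KERNEL V′: the same for the cohomological TR/CM anchor. -/
theorem cohomologicalAnchor_of_twist {K : Type} [Field K] [NumberField K] {ℓ : ℕ} [Fact ℓ.Prime] (ι : PadicAlgCl ℓ ≃+* ℂ)
    {n : ℕ} {ρ ρ' : Literature.NumberTheory.GaloisRepresentations.FramedGaloisRep K (PadicAlgCl ℓ) n}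
    (hχ : ∃ χ₁ : Field.absoluteGaloisGroup K →* PadicAlgCl ℓ, ∀ g : Field.absoluteGaloisGroup K,
      Literature.NumberTheory.GaloisRepresentations.FramedRep.charpoly ρ' g = (Literature.NumberTheory.GaloisRepresentations.FramedRep.charpoly ρ g).scaleRoots (χ₁ g))
    (h : HasCohomologicalAnchor K ℓ ι n ρ) : HasCohomologicalAnchor K ℓ ι n ρ' := by
  obtain ⟨χ₁, hχ₁⟩ := hχ
  obtain ⟨K₀, iF, iN, M, iFM, iNM, iA, iA₀, hty, hKM, hK₀M, σ₀, ρ₀, hA, χ, hχ⟩ := h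
  refine ⟨K₀, iF, iN, M, iFM, iNM, iA, iA₀, hty, hKM, hK₀M, σ₀, ρ₀, hA,
    χ * χ₁.comp (Literature.NumberTheory.GaloisRepresentations.absGaloisRestrict K M).toMonoidHom, fun g => ?_⟩
  have e1 : Literature.NumberTheory.GaloisRepresentations.FramedRep.charpoly (ρ'.restrictField M) g =
      Literature.NumberTheory.GaloisRepresentations.FramedRep.charpoly ρ' (Literature.NumberTheory.GaloisRepresentations.absGaloisRestrict K M g) := rfl
  have e2 : Literature.NumberTheory.GaloisRepresentations.FramedRep.charpoly (ρ.restrictField M) g =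
      Literature.NumberTheory.GaloisRepresentations.FramedRep.charpoly ρ (Literature.NumberTheory.GaloisRepresentations.absGaloisRestrict K M g) := rfl
  rw [e1, hχ₁, ← e2, hχ g, ← Polynomial.scaleRoots_mul]
  rfl

/-- EXACTNESS AT THE ROOT, on the ledger items: `Langlands` ⟺ RES ∧ FC ∧ LS ∧ FT ∧ CSD ∧ T′ ∧ FRAME′
((⟹) = `pieces_of_langlands`; (⟸) = the ROUTE FILE's deciding theorem `Theses.SymmetricPowerAnchorSplit.closes`). -/
theorem langlands_iff_pieces :
    _root_.Langlands ↔
      (AnchorlessSymTypeAutomorphy ∧ CMSymmetricPowerAutomorphy ∧ LowSymmetricPowerAutomorphy ∧ HilbertSymmetricPowerAutomorphy ∧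
        CliffordSolvableDescent ∧ SolvableAnchorTransport ∧ AvatarSymmetricPowerFrame) :=
  ⟨pieces_of_langlands, fun h =>
    Summit.Langlands.Langlands.Theses.SymmetricPowerAnchorSplit.closes h.1 h.2.1 h.2.2.1 h.2.2.2.1 h.2.2.2.2.1 h.2.2.2.2.2.1 h.2.2.2.2.2.2⟩

end Summit.Langlands.Langlands.Theorems.MonodromyDichotomySymmetricPowerAnchor
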